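import Mathlib

/-!
# Solo-blind seat (MatrixMultiplication), s68 — the DECOMPOSITION LEMMA for the Kraft inequality (K₃)
(SHARPEST §2T ADDENDUM s68, TRIANGLE.md (R18.2), CLAIMS c645)

Door I1⁗ (triangle rank schemes) closes negatively iff the lattice conjecture F/K′ holds; its 𝔽₃ skeleton is
the KRAFT INEQUALITY (K₃): for a zero-sum-free sequence `h` in an abelian group and every `τ`,
`K_h(τ) := Σ_{T : Σ_{i∈T} h i = τ} 2^{-|T|} ≤ 1` (over `𝔽₃^r`; verified exhaustively for `r ≤ 5`).

This file proves the structural reduction behind the induction on rank: for a subgroup `V`, split the index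
set into `w = {i : h i ∈ V}` and `u = {i : h i ∉ V}`.  Then
`K_h(τ) = Σ_{S ⊆ u} 2^{-|S|} · K_w(τ - h_S)` (`soloBlindKraft_split`), and since `K_w` is supported on `V`,
`K_h(τ) ≤ K_{u mod V}(τ mod V)`; so if the Kraft bound holds for the inside part `w` (a sequence in the smaller
group `V`) and for the outside part reduced modulo `V` (a sequence in `G ⧸ V`, zero-sum free iff no sub-sum of
`u` lands in `V`), it holds for `h` (`soloBlind_kraft_decomposition`).  Consequently (K₃) — and its analogues
K_G, K′ — need only be proved for INDECOMPOSABLE families.  Pure finite combinatorics; no `ω` content by itself.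
-/

set_option linter.dupNamespace false

namespace Summit.MatrixMultiplication.MatrixMultiplication.Theorems

open Finset BigOperators
open scoped Classical

section KraftDecomposition

variable {ι : Type*} {G : Type*} [AddCommGroup G]

/-- Kraft mass of the representations of `τ` as sub-sums of `h` supported inside `s`:
`K(s,h,τ) = Σ_{T ⊆ s, Σ_{i∈T} h i = τ} (1/2)^{|T|}`. -/
noncomputable def soloBlindKraft (s : Finset ι) (h : ι → G) (τ : G) : ℚ :=
  ∑ T ∈ (s.powerset.filter fun T => ∑ i ∈ T, h i = τ), ((1:ℚ)/2) ^ T.card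

/-- `K` is a sum of positive weights, hence nonnegative. -/
theorem soloBlindKraft_nonneg (s : Finset ι) (h : ι → G) (τ : G) : 0 ≤ soloBlindKraft s h τ := by
  unfold soloBlindKraft
  exact Finset.sum_nonneg fun T _ => by positivity

/-- `K` is supported on any subgroup containing the terms. -/
theorem soloBlindKraft_eq_zero_of_not_mem (s : Finset ι) (h : ι → G) (V : AddSubgroup G)
    (hs : ∀ i ∈ s, h i ∈ V) {σ : G} (hσ : σ ∉ V) : soloBlindKraft s h σ = 0 := by
  unfold soloBlindKraft
  apply Finset.sum_eq_zero
  intro T hT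
  exfalso
  rw [Finset.mem_filter, Finset.mem_powerset] at hT
  apply hσ
  rw [← hT.2]
  exact V.sum_mem fun i hi => hs i (hT.1 hi)

/-- The convolution identity `K_h(τ) = Σ_{S ⊆ u} 2^{-|S|} K_w(τ - h_S)` for the split of the index set by a
predicate `P` (`w = {P}`, `u = {¬P}`). -/
theorem soloBlindKraft_split (s : Finset ι) (h : ι → G) (P : ι → Prop) (τ : G) :
    soloBlindKraft s h τ =
      ∑ S ∈ (s.filter fun i => ¬ P i).powerset,
        ((1:ℚ)/2) ^ S.card * soloBlindKraft (s.filter P) h (τ - ∑ i ∈ S, h i) := by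
  set u := s.filter fun i => ¬ P i with hu_def
  set w := s.filter P with hw_def
  have hdisj : Disjoint u w := (Finset.disjoint_filter_filter_not s s P).symm
  have hR : ∑ S ∈ u.powerset, ((1:ℚ)/2) ^ S.card * soloBlindKraft w h (τ - ∑ i ∈ S, h i)
      = ∑ p ∈ ((u.powerset ×ˢ w.powerset).filter
          fun p : Finset ι × Finset ι => ∑ i ∈ p.2, h i = τ - ∑ i ∈ p.1, h i),
          ((1:ℚ)/2) ^ p.1.card * ((1:ℚ)/2) ^ p.2.card := by
    rw [Finset.sum_filter, Finset.sum_product]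
    apply Finset.sum_congr rfl
    intro S _
    unfold soloBlindKraft
    rw [Finset.sum_filter, Finset.mul_sum]
    apply Finset.sum_congr rfl
    intro T _
    dsimp only
    split_ifs <;> simp
  rw [hR]
  unfold soloBlindKraft
  apply Finset.sum_nbij' (fun T : Finset ι => ((T.filter fun i => ¬ P i), T.filter P))
    (fun p : Finset ι × Finset ι => p.1 ∪ p.2)
  · intro T hT
    rw [Finset.mem_filter, Finset.mem_powerset] at hT
    obtain ⟨hTs, hsum⟩ := hT
    rw [Finset.mem_filter, Finset.mem_product, Finset.mem_powerset, Finset.mem_powerset]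
    dsimp only
    refine ⟨⟨Finset.filter_subset_filter _ hTs, Finset.filter_subset_filter _ hTs⟩, ?_⟩
    rw [eq_sub_iff_add_eq, Finset.sum_filter_add_sum_filter_not, hsum]
  · intro p hp
    rw [Finset.mem_filter, Finset.mem_product, Finset.mem_powerset, Finset.mem_powerset] at hp
    obtain ⟨⟨h1, h2⟩, hsum⟩ := hp
    rw [Finset.mem_filter, Finset.mem_powerset]
    refine ⟨Finset.union_subset (h1.trans (Finset.filter_subset _ _))
      (h2.trans (Finset.filter_subset _ _)), ?_⟩
    rw [Finset.sum_union (hdisj.mono h1 h2), hsum, add_sub_cancel]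
  · intro T _
    dsimp only
    rw [Finset.union_comm, Finset.filter_union_filter_not_eq]
  · intro p hp
    rw [Finset.mem_filter, Finset.mem_product, Finset.mem_powerset, Finset.mem_powerset] at hp
    obtain ⟨⟨h1, h2⟩, _⟩ := hp
    have e1 : ∀ i ∈ p.1, ¬ P i := fun i hi => (Finset.mem_filter.mp (h1 hi)).2
    have e2 : ∀ i ∈ p.2, P i := fun i hi => (Finset.mem_filter.mp (h2 hi)).2
    have e2' : ∀ i ∈ p.2, ¬ ¬ P i := fun i hi => not_not.mpr (e2 i hi)
    refine Prod.ext ?_ ?_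
    · dsimp only
      rw [Finset.filter_union, Finset.filter_true_of_mem e1, Finset.filter_false_of_mem e2',
        Finset.union_empty]
    · dsimp only
      rw [Finset.filter_union, Finset.filter_false_of_mem e1, Finset.filter_true_of_mem e2,
        Finset.empty_union]
  · intro T _
    dsimp only
    rw [← pow_add, add_comm, Finset.card_filter_add_card_filter_not]

/-- DECOMPOSITION LEMMA (TRIANGLE.md (R18.2)).  If the Kraft bound holds for the terms of `h` inside the
subgroup `V` and for the terms outside `V` read in `G ⧸ V`, then it holds for `h`:
`K_h(τ) = Σ_{S ⊆ u} 2^{-|S|} K_w(τ - h_S) ≤ Σ_{S ⊆ u, h_S ≡ τ (mod V)} 2^{-|S|} = K_{u mod V}(τ mod V) ≤ 1`. -/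
theorem soloBlind_kraft_decomposition (s : Finset ι) (h : ι → G) (V : AddSubgroup G)
    (hw : ∀ σ : G, soloBlindKraft (s.filter fun i => h i ∈ V) h σ ≤ 1)
    (hu : ∀ c : G ⧸ V,
      soloBlindKraft (s.filter fun i => h i ∉ V) (fun i => QuotientAddGroup.mk' V (h i)) c ≤ 1)
    (τ : G) : soloBlindKraft s h τ ≤ 1 := by
  rw [soloBlindKraft_split s h (fun i => h i ∈ V) τ]
  set u := s.filter fun i => ¬ (h i ∈ V) with hu_def
  set w := s.filter fun i => h i ∈ V with hw_def
  have hwV : ∀ i ∈ w, h i ∈ V := fun i hi => (Finset.mem_filter.mp hi).2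
  calc ∑ S ∈ u.powerset, ((1:ℚ)/2) ^ S.card * soloBlindKraft w h (τ - ∑ i ∈ S, h i)
      ≤ ∑ S ∈ u.powerset, (if τ - ∑ i ∈ S, h i ∈ V then ((1:ℚ)/2) ^ S.card else 0) := by
        apply Finset.sum_le_sum
        intro S _
        split_ifs with hmem
        · calc ((1:ℚ)/2) ^ S.card * soloBlindKraft w h (τ - ∑ i ∈ S, h i)
              ≤ ((1:ℚ)/2) ^ S.card * 1 :=
                mul_le_mul_of_nonneg_left (hw _) (by positivity)
            _ = ((1:ℚ)/2) ^ S.card := mul_one _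
        · rw [soloBlindKraft_eq_zero_of_not_mem w h V hwV hmem, mul_zero]
    _ = soloBlindKraft u (fun i => QuotientAddGroup.mk' V (h i)) (QuotientAddGroup.mk' V τ) := by
        unfold soloBlindKraft
        rw [Finset.sum_filter]
        apply Finset.sum_congr rfl
        intro S _
        have key : (∑ i ∈ S, QuotientAddGroup.mk' V (h i) = QuotientAddGroup.mk' V τ) ↔
            (τ - ∑ i ∈ S, h i ∈ V) := by
          rw [← map_sum, eq_comm, QuotientAddGroup.mk'_apply, QuotientAddGroup.mk'_apply,
            QuotientAddGroup.eq_iff_sub_mem]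
        simp only [key]
    _ ≤ 1 := hu _


end KraftDecomposition

end Summit.MatrixMultiplication.MatrixMultiplication.Theorems
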